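import Summits.Ventures.CertifiedManyBodySolver.Downfold.EmeryFermiSurfaceShapeBox
import Summits.Ventures.CertifiedManyBodySolver.Downfold.EmeryAntibondingBand
import HarnessLib

/-!
# The energy denominator is non-negative on the antibonding sheet: the first-order hopping scale of the
# near-Fermi-surface `t–t′` model has the sign of its shape weight

Venture CertifiedManyBodySolver, cell `pub/hubbard-downfold` (stage S1), seat hubbard-downfold-mod-4
(technique B); namespace `Summit.Ventures.CertifiedManyBodySolver.Downfold.Emery`. Everything here is PROVED.
WHAT THIS IS NOT: a statement about any material.

`EmeryFermiSurfaceShapeBox` §2 defines `dcharCubic = ∂_ε charCubic` and the first-order scale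
`scaleT = fsT/∂_ε charCubic`, bracketed along a contour by two reference points; `EmeryAntibondingBand`
defines the antibonding band `abBand` as the LARGEST root of the secular cubic. Here the two meet:

* `monicCubic_deriv_nonneg_at_topRoot` — at the largest real root `r` of a monic cubic,
  `p′(r) = 3r² + 2ar + b ≥ 0` (otherwise `p` dips below zero just above `r` and the intermediate value
  theorem produces a larger root);
* `dcharCubic_eq_deriv` — `dcharCubic` IS `3ε² + 2·cubA·ε + cubB`;
* `dcharCubic_abBand_nonneg` — hence `∂_ε charCubic ≥ 0` at every point of every constant-energy contour
  OF THE ANTIBONDING BAND, and `scaleT_abBand_nonneg`: the first-order hopping scale there is `≥ 0`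
  whenever the shape weight `fsT = fsD + 2fsN` is (cuprate regime) — the near-Fermi-surface `t–t′` model
  inherits the sign convention `t > 0` of the hubbard-fast dictionary without a choice.

Sources: [HybertsenSchluterChristensen1989, Eq. (1)]; elementary calculus of cubics.
-/

noncomputable section

namespace Summit.Ventures.CertifiedManyBodySolver.Downfold.Emery

open Real

/-- At the largest real root `r = topRoot a b d` of the monic cubic, the derivative `3r² + 2ar + b` is
non-negative. [folklore] -/
theorem monicCubic_deriv_nonneg_at_topRoot (a b d : ℝ) :
    0 ≤ 3 * topRoot a b d ^ 2 + 2 * a * topRoot a b d + b := by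
  set r := topRoot a b d with hr
  by_contra hneg
  push Not at hneg
  -- choose a small step h > 0 with h·(|3r + a| + 1) ≤ −p′(r)/2
  set q := 3 * r ^ 2 + 2 * a * r + b with hq
  have hqneg : q < 0 := hneg
  set K := |3 * r + a| + 1 with hK
  have hKpos : 0 < K := by positivity
  set h := min 1 (-q / (2 * K)) with hh
  have hhpos : 0 < h := by
    rw [hh]
    apply lt_min zero_lt_one
    exact div_pos (by linarith) (by linarith)
  have hh1 : h ≤ 1 := min_le_left _ _
  have hh2 : h ≤ -q / (2 * K) := min_le_right _ _
  have hhK : h * (2 * K) ≤ -q := by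
    have := (le_div_iff₀ (by linarith : (0:ℝ) < 2 * K)).mp hh2
    linarith
  -- Taylor at r: p(r + h) = 0 + h q + h² (3r + a) + h³
  have hroot : monicCubic a b d r = 0 := monicCubic_topRoot a b d
  have ht := monicCubic_taylor a b d r (r + h)
  have hstep : r + h - r = h := by ring
  rw [hstep, hroot, zero_add] at ht
  -- bound the higher-order terms: h²(3r + a) + h³ ≤ h²(|3r+a| + 1) = h² K ≤ h · (−q/2)
  have hb1 : (3 * r + a) * h ^ 2 ≤ |3 * r + a| * h ^ 2 :=
    mul_le_mul_of_nonneg_right (le_abs_self _) (sq_nonneg _)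
  have hb2 : h ^ 3 ≤ h ^ 2 := by nlinarith
  have hval : monicCubic a b d (r + h) ≤ h * q / 2 := by
    rw [ht]
    nlinarith
  have hnegval : monicCubic a b d (r + h) < 0 := by
    have : h * q / 2 < 0 := by nlinarith
    linarith
  -- a root ≥ r + h exists, contradicting maximality of r
  obtain ⟨s, hs, hs0⟩ := exists_root_ge_of_nonpos hnegval.le
  have hle : s ≤ r := le_topRoot_of_root hs0
  linarith

/-- `dcharCubic` is the derivative polynomial `3ε² + 2·cubA·ε + cubB` of the monic secular cubic.
[folklore] -/
theorem dcharCubic_eq_deriv (Δ tpd tpp c x y ε : ℝ) :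
    dcharCubic Δ tpd tpp c x y ε = 3 * ε ^ 2 + 2 * cubA Δ c x y * ε + cubB Δ tpd tpp c x y := by
  unfold dcharCubic dcA dfsD dfsN cubA cubB
  ring

/-- ON THE ANTIBONDING SHEET the energy denominator is non-negative:
`∂_ε charCubic(x, y, ε_AB(x, y)) ≥ 0`. [folklore] -/
theorem dcharCubic_abBand_nonneg (Δ tpd tpp c x y : ℝ) :
    0 ≤ dcharCubic Δ tpd tpp c x y (abBand Δ tpd tpp c x y) := by
  rw [dcharCubic_eq_deriv]
  exact monicCubic_deriv_nonneg_at_topRoot _ _ _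

/-- Hence the first-order hopping scale of the near-Fermi-surface `t–t′` model at an antibonding Fermi
point is `≥ 0` whenever the shape weight `fsT = fsD + 2fsN` is (`t > 0` convention inherited, not chosen).
[folklore] -/
theorem scaleT_abBand_nonneg (Δ tpd tpp c x y : ℝ)
    (hT : 0 ≤ fsT Δ tpd tpp c (abBand Δ tpd tpp c x y)) :
    0 ≤ scaleT Δ tpd tpp c x y (abBand Δ tpd tpp c x y) := by
  unfold scaleT
  exact div_nonneg hT (dcharCubic_abBand_nonneg Δ tpd tpp c x y)

end Summit.Ventures.CertifiedManyBodySolver.Downfold.Emery
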